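import Summits.ResolutionOfSingularities.ResolutionOfSingularities.Theorems.FrobeniusLadderFRationalResolutionTameEtaleLocalResolution
import HarnessLib

/-!
# Crux `FrobeniusLadder.FRationalResolution` (stmt-ResolutionOfSingularities-15317), line `redirect`,
# stub `stub_diagonalizableQuotientResolution` — WILD OR TAME: a point of `X` lying under a
# `D(A)`-FIXED point of one of the stub's regular quotient charts has a resolvable étale neighbourhood

Companion of `…TameEtaleLocalResolution` without the tameness hypothesis, at the price of asking the
chart point to be fixed: under the stub's `hq` verbatim (any field `k`, any finite abelian `A`, so
`D(A)` possibly non-reduced), if `x = φ(v)` for a chart `φ : Spec S₀ → X` and a prime `𝔔` of `S` over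
`v` containing every `S_a`, `a ≠ 0`, then `x` has an étale neighbourhood `Spec T → X` with
`Scheme.HasResolution (Spec T)` (`…FixedPointResolvableNhd.exists_hasResolution_away_of_fixed` +
`…TameEtaleLocalResolution.exists_etale_nhd_of_away`). The non-fixed wild points are the remaining
case (memo MEMO-15317-leafhand2-g4 §2 (W)).

* `exists_etale_nhd_hasResolution_of_fixed_chart_point` — the statement above.

Honest label: corollary (no stub closed). No definitions, no named facts, no sorry.
[cite: Kato1994, (10.4)]
-/

noncomputable section

-- single-problem summit: the doubled namespace component is forced
set_option linter.dupNamespace false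

open CategoryTheory AlgebraicGeometry Literature.AlgebraicGeometry.Resolution

namespace Summit.ResolutionOfSingularities.ResolutionOfSingularities.Theorems.FRationalResolution.FixedEtaleLocalResolution

/-- **Points under fixed chart points are étale-locally resolvable (every field, tame or wild).**
For a chart `φ : Spec S₀ → X` of the stub's shape (`S` regular of finite type over `k` graded by a
finite abelian group `A`, `φ` étale), a point `v` of `Spec S₀` and a prime `𝔔` of `S` over `v` which
is `D(A)`-fixed (`S_a ⊆ 𝔔` for `a ≠ 0`): `φ v` has an étale neighbourhood `ψ : Spec T → X` with
`Scheme.HasResolution (Spec T)`. [cite: Kato1994, (10.4)] -/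
theorem exists_etale_nhd_hasResolution_of_fixed_chart_point (k : Type) [Field k] (X : Scheme.{0})
    (A : Type) [AddCommGroup A] [Finite A] [DecidableEq A] (S : Type) [CommRing S] [Algebra k S]
    (𝒮 : A → Submodule k S) [GradedAlgebra 𝒮] [Algebra.FiniteType k S] [IsRegularRing S]
    (φ : Spec (.of (𝒮 0)) ⟶ X) [Etale φ] (v : Spec (.of (𝒮 0)))
    (𝔔 : Ideal S) [𝔔.IsPrime] (h𝔔v : 𝔔.comap (algebraMap (𝒮 0) S) = v.asIdeal)
    (hfix : ∀ a : A, a ≠ 0 → ∀ s ∈ 𝒮 a, s ∈ 𝔔) :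
    ∃ (T : Type) (_ : CommRing T) (ψ : Spec (.of T) ⟶ X),
      Etale ψ ∧ φ v ∈ Set.range ψ ∧ Scheme.HasResolution (Spec (.of T)) := by
  have hA : AddMonoid.IsTorsion A := fun a => isOfFinAddOrder_of_finite a
  obtain ⟨g, hg, hres⟩ :=
    FixedPointResolvableNhd.exists_hasResolution_away_of_fixed 𝒮 hA 𝔔 hfix
  have hvg : g ∉ v.asIdeal := by
    rw [← h𝔔v, Ideal.mem_comap]
    exact hg
  exact TameEtaleLocalResolution.exists_etale_nhd_of_away g φ v hvg hres

end Summit.ResolutionOfSingularities.ResolutionOfSingularities.Theorems.FRationalResolution.FixedEtaleLocalResolution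

end
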